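import Summits.ABC.ABC.Theorems.IneffectiveSubspacePrimePowerRadicalStubCashout
import Summits.ABC.ABC.Theorems.IneffectiveSubspacePrimePowerRadicalStubVojtaShapeOfCrux

/-!
# Calibration `stub_towerBet_iff_PPRAt`: on the family, the tower bet at a prime base IS the crux at that base

Stub `stub_towerBet_iff_PPRAt` (registered, skeleton 8e3467c0 of lead c1) of the line `nevbir-below-beta` for the
crux `Summit.ABC.ABC.Theses.IneffectiveSubspace.PrimePowerRadical` (stmt-ABC-1648), with the skeleton-local
definitions `TowerIneq` / `towerG` of `Cruxes/PrimePowerRadical/Lines/nevbir_below_beta.lean` unfolded and the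
exceptional curve cut to `F = 1` (lead c1's L1 reshape).

THE TOWER BET at a prime `q` (the line's concluding stub `stub_tower_toVojta`, quantified over the target exponent
`θ > 0`): for every `θ > 0` some level `n ≥ 3` carries weights `c_i ≥ c_min`, `b_H, b_Y, ε ≥ 0` with
`κ_n := (1+ε)c_min − b_Y(n+1)/(2n) > 0`, `0 ≤ θ₀ := 1 + ε − 2b_H − b_Y ≤ θ·κ_n`, and a constant `C` such that for
all `k ≥ 1` and all `u ∣ q^k − 1`
`b_H·2h + b_Y·(h − log u) ≤ (1+ε)·(h − Σ_{p ∣ q^k−1} (Σ_{i<n} c_i·min(v_p(q^k−1) − i·v_p(u), v_p(u))⁺)·log p) + C`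
(`h = k log q`). THE CRUX at `q` (`PPRAt q`): `∀ ε > 0 ∃ C > 0 ∀ k ≥ 1, q^k < C·rad(1·(q^k−1)·q^k)^{1+ε}`.

`stub_towerBet_iff_PPRAt : towerBet q ↔ PPRAt q` for every prime `q`, hence
`primePowerRadical_iff_towerBet : PrimePowerRadical ↔ ∀ q prime, towerBet q`.

* (→) `wieferichSparse_of_towerBet`: given `θ > 0`, the bet at `θ` and the landed adaptive-design cash-out
  `stub_cashout` (the on-curve hypothesis is vacuous for `F = 1`) give `q^k − 1 ≤ C·q^{(θ₀/κ_n)k}·rad(q^k − 1)` with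
  `θ₀/κ_n ≤ θ`; the landed sandwich `Negative.oddWieferichExcess_mul_radical_dvd` (`E_W(q,k)·rad(q^k−1) ∣ q^k − 1`)
  turns this into Wieferich sparsity `E_W(q,k) < (|C|+1)·q^{θk}`, and `Negative.PPRAt_of_wieferichSparse` into the
  crux at `q`. (This is the composition `PrimePowerRadical_of` of the planner's skeleton, read as a theorem about
  the bet.)
* (←) `towerBet_of_PPRAt`: given the crux at `q` and `θ > 0`, the landed necessary direction
  `stub_vojtaShape_of_crux` at level `n = 3` with the Vojta shape `c_i = b_H = b_Y = b := 3/(9+θ)`, `ε = 0`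
  supplies the inequality; its parameters satisfy `κ_3 = b/3 > 0`, `θ₀ = 1 − 3b = θ/(9+θ) ≥ 0` and
  `θ₀ = θ·κ_3` exactly, so the margin condition holds with equality.

Consequence recorded for the crux dossier (lead c2): together with `Negative.primePowerRadical_iff_wieferichSparse`
(p74591), `Brjuno.stub_wall_of_wdc` (p90621) and `stub_level2_iff_sqDivisorBound` (p111511), every concluding stub of
every line offered for this crux is kernel-certified to be the crux at `q` (tower bet), stronger (WDC), or a rung of
the Wieferich level ladder (level-2 bet) — all behind the double wall `Negative.primePowerRadical_dichotomy` (p78703).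

Sources: the line file `Cruxes/PrimePowerRadical/Lines/nevbir_below_beta.lean` (composition `PrimePowerRadical_of`,
docstring of `stub_vojtaShape_of_crux`: "margin ratio (1−3b)·2n/(b(n−1)) → 0 as b ↑ 1/3"); landed
`NevbirBelowBeta.stub_cashout`, `NevbirBelowBeta.stub_vojtaShape_of_crux`, `Negative.oddWieferichExcess_mul_radical_dvd`,
`Negative.PPRAt_of_wieferichSparse`. Deliberately NOT here: any claim that the bet holds (it is the crux).
-/

noncomputable section

-- `Summit.<Summit>.<Problem>` is the mandated summit-side namespace (CONVENTIONS §2); for the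
-- single-conjunct summit `ABC` the two coincide, so the duplicate `ABC.ABC` is deliberate.
set_option linter.dupNamespace false

namespace Summit.ABC.ABC.Theorems.PrimePowerRadical.NevbirBelowBeta

open Literature.NumberTheory.DiophantineGeometry UniqueFactorizationMonoid
open Summit.ABC.ABC.Theses.IneffectiveSubspace
open Summit.ABC.ABC.Theorems.PrimePowerRadical.Negative
open scoped BigOperators

/-! ## (→) The bet at exponent `θ` cashes out to Wieferich sparsity at exponent `θ` -/

/-- **One level of the bet ⟹ Wieferich sparsity at its margin ratio.** If some level `n ≥ 3` carries the weighted
inequality (with `F = 1`) and parameters `c_i ≥ c_min`, `b_Y, ε ≥ 0`, `κ_n > 0`, `0 ≤ θ₀ ≤ θ·κ_n`, then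
`E_W(q,k) < C·q^{θk}` for all `k ≥ 1` with some `C > 0`: `stub_cashout` (vacuous on-curve hypothesis) and the
sandwich `E_W·rad ∣ q^k − 1`. -/
theorem wieferichSparse_of_towerLevel {q : ℕ} (hq : q.Prime) {θ : ℝ} {n : ℕ} (hn : 3 ≤ n)
    {c : ℕ → ℝ} {cmin bH bY ε : ℝ}
    (hc : ∀ i : ℕ, i < n → cmin ≤ c i) (hbY : 0 ≤ bY) (hε : 0 ≤ ε)
    (hκ : 0 < (1 + ε) * cmin - bY * (((n : ℝ) + 1) / (2 * n)))
    (hθ0 : 0 ≤ 1 + ε - 2 * bH - bY)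
    (hmargin : 1 + ε - 2 * bH - bY ≤ θ * ((1 + ε) * cmin - bY * (((n : ℝ) + 1) / (2 * n))))
    (hineq : ∃ C : ℝ, ∀ k : ℕ, 1 ≤ k → ∀ u : ℕ, u ∣ q ^ k - 1 →
      MvPolynomial.eval ![((q : ℤ) ^ k), (u : ℤ)] (1 : MvPolynomial (Fin 2) ℤ) ≠ 0 →
        bH * (2 * ((k : ℝ) * Real.log q)) + bY * ((k : ℝ) * Real.log q - Real.log u)
          ≤ (1 + ε) * ((k : ℝ) * Real.log q -
              ∑ p ∈ (q ^ k - 1).primeFactors,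
                (∑ i ∈ Finset.range n, c i *
                  ((min ((q ^ k - 1).factorization p - i * u.factorization p) (u.factorization p) : ℕ) : ℝ))
                * Real.log p) + C) :
    ∃ C : ℝ, 0 < C ∧ ∀ k : ℕ, 1 ≤ k → (oddWieferichExcess q k : ℝ) < C * (q : ℝ) ^ (θ * k) := by
  -- the on-curve hypothesis of `stub_cashout` is vacuous for `F = 1`
  have hexc : ∃ C : ℝ, ∀ k : ℕ, 1 ≤ k → ∀ u : ℕ, u ^ 2 ∣ q ^ k - 1 →
      MvPolynomial.eval ![((q : ℤ) ^ k), (u : ℤ)] (1 : MvPolynomial (Fin 2) ℤ) = 0 → (u : ℝ) ≤ C :=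
    ⟨0, fun k _ u _ h0 => by simp at h0⟩
  obtain ⟨C, hC⟩ := stub_cashout hq.two_le hn hc hbY hε hκ hθ0 hineq hexc
  have hq0 : (0 : ℝ) < q := by exact_mod_cast hq.pos
  have hq1 : (1 : ℝ) ≤ q := by exact_mod_cast hq.one_lt.le
  have hρθ : (1 + ε - 2 * bH - bY) / ((1 + ε) * cmin - bY * (((n : ℝ) + 1) / (2 * n))) ≤ θ := by
    rw [div_le_iff₀ hκ]; exact hmargin
  refine ⟨|C| + 1, by positivity, fun k hk => ?_⟩
  have hm0 : 0 < q ^ k - 1 := by have := two_le_pow hq.two_le hk; omega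
  have hle : oddWieferichExcess q k * radical (q ^ k - 1) ≤ q ^ k - 1 :=
    Nat.le_of_dvd hm0 (oddWieferichExcess_mul_radical_dvd hq.two_le hk)
  have hleR : (oddWieferichExcess q k : ℝ) * ((radical (q ^ k - 1) : ℕ) : ℝ) ≤ ((q ^ k - 1 : ℕ) : ℝ) := by
    exact_mod_cast hle
  have hR0 : (0 : ℝ) < ((radical (q ^ k - 1) : ℕ) : ℝ) := by exact_mod_cast Nat.radical_pos _
  have h1 := hleR.trans (hC k hk)
  have h2 : (oddWieferichExcess q k : ℝ) ≤
      C * (q : ℝ) ^ ((1 + ε - 2 * bH - bY) / ((1 + ε) * cmin - bY * (((n : ℝ) + 1) / (2 * n))) * k) :=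
    le_of_mul_le_mul_right h1 hR0
  have h3 : (q : ℝ) ^ ((1 + ε - 2 * bH - bY) / ((1 + ε) * cmin - bY * (((n : ℝ) + 1) / (2 * n))) * k)
      ≤ (q : ℝ) ^ (θ * k) := by
    apply Real.rpow_le_rpow_of_exponent_le hq1
    exact mul_le_mul_of_nonneg_right hρθ (Nat.cast_nonneg k)
  have h4 : (0 : ℝ) < (q : ℝ) ^ (θ * k) := Real.rpow_pos_of_pos hq0 _
  have h5 : (0 : ℝ) ≤
      (q : ℝ) ^ ((1 + ε - 2 * bH - bY) / ((1 + ε) * cmin - bY * (((n : ℝ) + 1) / (2 * n))) * k) :=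
    Real.rpow_nonneg hq0.le _
  calc (oddWieferichExcess q k : ℝ)
      ≤ C * (q : ℝ) ^ ((1 + ε - 2 * bH - bY) / ((1 + ε) * cmin - bY * (((n : ℝ) + 1) / (2 * n))) * k) := h2
    _ ≤ |C| * (q : ℝ) ^ ((1 + ε - 2 * bH - bY) / ((1 + ε) * cmin - bY * (((n : ℝ) + 1) / (2 * n))) * k) :=
        mul_le_mul_of_nonneg_right (le_abs_self C) h5
    _ ≤ |C| * (q : ℝ) ^ (θ * k) := mul_le_mul_of_nonneg_left h3 (abs_nonneg C)
    _ < (|C| + 1) * (q : ℝ) ^ (θ * k) := by nlinarith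

/-- **(→) The tower bet at `q` ⟹ the crux at `q`.** For each `θ > 0` the bet supplies a level as in
`wieferichSparse_of_towerLevel`, so `E_W(q,k) < C_θ·q^{θk}` for every `θ > 0` (Wieferich sparsity at `q`), and
`Negative.PPRAt_of_wieferichSparse` gives the crux at `q`. -/
theorem PPRAt_of_towerBet {q : ℕ} (hq : q.Prime)
    (hbet : ∀ θ : ℝ, 0 < θ → ∃ n : ℕ, 3 ≤ n ∧ ∃ (c : ℕ → ℝ) (cmin bH bY ε : ℝ),
      (∀ i : ℕ, i < n → cmin ≤ c i) ∧ 0 ≤ bH ∧ 0 ≤ bY ∧ 0 ≤ ε ∧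
      0 < (1 + ε) * cmin - bY * (((n : ℝ) + 1) / (2 * n)) ∧ 0 ≤ 1 + ε - 2 * bH - bY ∧
      1 + ε - 2 * bH - bY ≤ θ * ((1 + ε) * cmin - bY * (((n : ℝ) + 1) / (2 * n))) ∧
      ∃ C : ℝ, ∀ k : ℕ, 1 ≤ k → ∀ u : ℕ, u ∣ q ^ k - 1 →
        MvPolynomial.eval ![((q : ℤ) ^ k), (u : ℤ)] (1 : MvPolynomial (Fin 2) ℤ) ≠ 0 →
          bH * (2 * ((k : ℝ) * Real.log q)) + bY * ((k : ℝ) * Real.log q - Real.log u)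
            ≤ (1 + ε) * ((k : ℝ) * Real.log q -
                ∑ p ∈ (q ^ k - 1).primeFactors,
                  (∑ i ∈ Finset.range n, c i *
                    ((min ((q ^ k - 1).factorization p - i * u.factorization p) (u.factorization p) : ℕ) : ℝ))
                  * Real.log p) + C)
    (ε : ℝ) (hε : 0 < ε) :
    ∃ C : ℝ, 0 < C ∧ ∀ k : ℕ, 1 ≤ k →
      ((q ^ k : ℕ) : ℝ) < C * ((rad 1 (q ^ k - 1) (q ^ k) : ℕ) : ℝ) ^ (1 + ε) := by
  apply PPRAt_of_wieferichSparse hq _ ε hε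
  intro θ hθ
  obtain ⟨n, hn, c, cmin, bH, bY, ε', hc, _hbH, hbY, hε', hκ, hθ0, hmargin, hineq⟩ := hbet θ hθ
  exact wieferichSparse_of_towerLevel hq hn hc hbY hε' hκ hθ0 hmargin hineq

/-! ## (←) The crux at `q` supplies the bet, with the Vojta shape at level 3 -/

/-- **(←) The crux at `q` ⟹ the tower bet at `q`.** Given `θ > 0`, take level `n = 3` and the Vojta shape
`c_i = b_H = b_Y = b := 3/(9+θ) ∈ (0, 1/3)`, `ε = 0`: the landed `stub_vojtaShape_of_crux` gives the inequality, and
`κ_3 = b − (2/3)b = b/3 > 0`, `θ₀ = 1 − 3b = θ/(9+θ) = θ·κ_3`. -/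
theorem towerBet_of_PPRAt {q : ℕ} (hq : q.Prime)
    (h : ∀ ε : ℝ, 0 < ε → ∃ C : ℝ, 0 < C ∧ ∀ k : ℕ, 1 ≤ k →
      ((q ^ k : ℕ) : ℝ) < C * ((rad 1 (q ^ k - 1) (q ^ k) : ℕ) : ℝ) ^ (1 + ε))
    (θ : ℝ) (hθ : 0 < θ) :
    ∃ n : ℕ, 3 ≤ n ∧ ∃ (c : ℕ → ℝ) (cmin bH bY ε : ℝ),
      (∀ i : ℕ, i < n → cmin ≤ c i) ∧ 0 ≤ bH ∧ 0 ≤ bY ∧ 0 ≤ ε ∧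
      0 < (1 + ε) * cmin - bY * (((n : ℝ) + 1) / (2 * n)) ∧ 0 ≤ 1 + ε - 2 * bH - bY ∧
      1 + ε - 2 * bH - bY ≤ θ * ((1 + ε) * cmin - bY * (((n : ℝ) + 1) / (2 * n))) ∧
      ∃ C : ℝ, ∀ k : ℕ, 1 ≤ k → ∀ u : ℕ, u ∣ q ^ k - 1 →
        MvPolynomial.eval ![((q : ℤ) ^ k), (u : ℤ)] (1 : MvPolynomial (Fin 2) ℤ) ≠ 0 →
          bH * (2 * ((k : ℝ) * Real.log q)) + bY * ((k : ℝ) * Real.log q - Real.log u)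
            ≤ (1 + ε) * ((k : ℝ) * Real.log q -
                ∑ p ∈ (q ^ k - 1).primeFactors,
                  (∑ i ∈ Finset.range n, c i *
                    ((min ((q ^ k - 1).factorization p - i * u.factorization p) (u.factorization p) : ℕ) : ℝ))
                  * Real.log p) + C := by
  set b : ℝ := 3 / (9 + θ) with hbdef
  have h9 : 0 < 9 + θ := by linarith
  have hb0 : 0 < b := div_pos (by norm_num) h9
  have hb3 : b < 1 / 3 := by
    rw [hbdef, div_lt_iff₀ h9]; linarith
  have hb9 : b * (9 + θ) = 3 := by
    rw [hbdef]; field_simp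
  obtain ⟨C, hC⟩ := stub_vojtaShape_of_crux hq h 3 hb0 hb3
  refine ⟨3, le_refl _, fun _ => b, b, b, b, 0, fun _ _ => le_refl _, hb0.le, hb0.le, le_refl _, ?_, ?_, ?_,
    C, ?_⟩
  · -- κ₃ = b/3 > 0
    push_cast; nlinarith
  · -- θ₀ = 1 − 3b ≥ 0
    linarith
  · -- θ₀ ≤ θ·κ₃ (equality)
    push_cast; nlinarith
  · intro k hk u hu hF
    exact hC k hk u hu hF

/-! ## The registered stub and the crux-level corollary -/

/-- **stub_towerBet_iff_PPRAt (registered calibration stub of line `nevbir-below-beta`, lead c1's skeleton).** At a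
prime base `q`, the tower bet (the line's concluding stub `stub_tower_toVojta` at `q`, all `θ > 0`) holds if and only
if the crux holds at `q`. So the line's one remaining composition stub is the crux at `q` itself — neither weaker
(`PPRAt_of_towerBet`) nor stronger (`towerBet_of_PPRAt`). -/
theorem stub_towerBet_iff_PPRAt {q : ℕ} (hq : q.Prime) :
    (∀ θ : ℝ, 0 < θ → ∃ n : ℕ, 3 ≤ n ∧ ∃ (c : ℕ → ℝ) (cmin bH bY ε : ℝ),
      (∀ i : ℕ, i < n → cmin ≤ c i) ∧ 0 ≤ bH ∧ 0 ≤ bY ∧ 0 ≤ ε ∧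
      0 < (1 + ε) * cmin - bY * (((n : ℝ) + 1) / (2 * n)) ∧ 0 ≤ 1 + ε - 2 * bH - bY ∧
      1 + ε - 2 * bH - bY ≤ θ * ((1 + ε) * cmin - bY * (((n : ℝ) + 1) / (2 * n))) ∧
      ∃ C : ℝ, ∀ k : ℕ, 1 ≤ k → ∀ u : ℕ, u ∣ q ^ k - 1 →
        MvPolynomial.eval ![((q : ℤ) ^ k), (u : ℤ)] (1 : MvPolynomial (Fin 2) ℤ) ≠ 0 →
          bH * (2 * ((k : ℝ) * Real.log q)) + bY * ((k : ℝ) * Real.log q - Real.log u)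
            ≤ (1 + ε) * ((k : ℝ) * Real.log q -
                ∑ p ∈ (q ^ k - 1).primeFactors,
                  (∑ i ∈ Finset.range n, c i *
                    ((min ((q ^ k - 1).factorization p - i * u.factorization p) (u.factorization p) : ℕ) : ℝ))
                  * Real.log p) + C) ↔
    (∀ ε : ℝ, 0 < ε → ∃ C : ℝ, 0 < C ∧ ∀ k : ℕ, 1 ≤ k →
      ((q ^ k : ℕ) : ℝ) < C * ((rad 1 (q ^ k - 1) (q ^ k) : ℕ) : ℝ) ^ (1 + ε)) :=
  ⟨fun hbet => PPRAt_of_towerBet hq hbet, fun h => towerBet_of_PPRAt hq h⟩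

/-- **The crux ⟺ the tower bet at every prime base** (`stub_towerBet_iff_PPRAt` under `∀ q prime`): the typed
content of line `nevbir-below-beta` that concludes the crux is a REFORMULATION of the crux, certified in both
directions; what the line adds beyond the crux is only the (refuted, `Lines/nevbir-below-beta-dead.md`) geometric
provenance of the constants. -/
theorem primePowerRadical_iff_towerBet :
    PrimePowerRadical ↔
    ∀ q : ℕ, q.Prime → ∀ θ : ℝ, 0 < θ → ∃ n : ℕ, 3 ≤ n ∧ ∃ (c : ℕ → ℝ) (cmin bH bY ε : ℝ),
      (∀ i : ℕ, i < n → cmin ≤ c i) ∧ 0 ≤ bH ∧ 0 ≤ bY ∧ 0 ≤ ε ∧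
      0 < (1 + ε) * cmin - bY * (((n : ℝ) + 1) / (2 * n)) ∧ 0 ≤ 1 + ε - 2 * bH - bY ∧
      1 + ε - 2 * bH - bY ≤ θ * ((1 + ε) * cmin - bY * (((n : ℝ) + 1) / (2 * n))) ∧
      ∃ C : ℝ, ∀ k : ℕ, 1 ≤ k → ∀ u : ℕ, u ∣ q ^ k - 1 →
        MvPolynomial.eval ![((q : ℤ) ^ k), (u : ℤ)] (1 : MvPolynomial (Fin 2) ℤ) ≠ 0 →
          bH * (2 * ((k : ℝ) * Real.log q)) + bY * ((k : ℝ) * Real.log q - Real.log u)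
            ≤ (1 + ε) * ((k : ℝ) * Real.log q -
                ∑ p ∈ (q ^ k - 1).primeFactors,
                  (∑ i ∈ Finset.range n, c i *
                    ((min ((q ^ k - 1).factorization p - i * u.factorization p) (u.factorization p) : ℕ) : ℝ))
                  * Real.log p) + C :=
  ⟨fun h q hq => (stub_towerBet_iff_PPRAt hq).2 (h q hq), fun h q hq => (stub_towerBet_iff_PPRAt hq).1 (h q hq)⟩

end Summit.ABC.ABC.Theorems.PrimePowerRadical.NevbirBelowBeta

end
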